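import Mathlib
import Literature.MathematicalPhysics.QuantumFieldTheory.Balaban1983to89.B2Eq228Conditioning

/-!
# `Balaban1983to89.B1Eq333GaussianFields` — T. Bałaban, *(Higgs)₂,₃ quantum fields in a finite volume. I. A lower bound*,
Commun. Math. Phys. **85** (1982) 603–626 [Balaban1982Higgs1], the sentence after (3.33) p. 617: *"The fields A′_j
defining the components of (3.33) are independent Gaussian random variables with the covariances C^{(j),L^jε}. Also they
are independent of the field A on the L^kε-lattice, defining the configuration A^{(k),ε}."* — PROVED, with Mathlib's
probability theory, for the measure the print integrates against in (3.35): the product of the normalised Gaussian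
densities `exp(−½⟨A′_j,(C^{(j),L^jε})⁻¹A′_j⟩)dA′_j`, `j = 0, …, k − 1`, times the law of the field `A`; theorems only over a
small carrier (no new `Prop` fact)

statement-level skeleton of published theorems with citation tags; proofs where landed; nothing here is a claim about the Yang–Mills mass gap

PDF held: `paper:balaban1982-cmp85-higgs23-i` (journal page = PDF page + 602); pp. 617–618 READ AS IMAGES on the ×2
renders `run/shared/lean/pub/pub-balaban/b2b-balaban-ref1/pages/1982-cmp85-higgs23-I/1982-cmp85-higgs23-I-p015-x2.png`,
`…-p016-x2.png`.  Unit `lit-balaban-r14` gen 4 (reader/typer and fold owner of block B1), HOME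
`run/shared/lean/pub/lit-balaban/`.  SKELETON row **B1.Eq3.33** ((3.33) p. 617; head `typed p243529`: the decomposition
`A = A′^{(0),ε} + … + A′^{(k−1),ε} + A^{(k),ε}` along a consistent tower is PROVED in p14's
`…B1Eq333Decomposition.eq333`; the row's one member listed «absent» by both readers (r12, r14) was *"the accompanying
sentence «A′^{(j)} independent Gaussian variables with covariances Γ^{(j)}» (the probabilistic content is not
modelled)"* — this file models and proves it).

WHAT IS PRINTED (verbatim).  p. 617 [PDF 15]: *"At first let us notice that after k successive renormalization
transformations together with the corresponding translations, the field A with which we have started in the first step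
is represented as A = A′^{(0),ε} + A′^{(1),ε} + … + A′^{(k−1),ε} + A^{(k),ε}, (3.33) where A′^{(j),ε} are given by the
formula (3.29) with A′_j instead of A. The fields A′_j defining the components of (3.33) are independent Gaussian random
variables with the covariances C^{(j),L^jε}. Also they are independent of the field A on the L^kε-lattice, defining the
configuration A^{(k),ε}."*  p. 618 [PDF 16], the measure this refers to, inside (3.35): *"E_k(e′,λ′,eA^{(k),ε},φ) =
−log[(a(L^kε)^{d−2}/2π)^{(d/2)|T₁^{(k)}|}·∫dA′_{k−1} exp(−½⟨A′_{k−1},(C^{(k−1),L^{k−1}ε})⁻¹A′_{k−1}⟩)·…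
·(a(Lε)^{d−2}/2π)^{(d/2)|T₁^{(1)}|}∫dA′₀ exp(−½⟨A′₀,(C^{(0),ε})⁻¹A′₀⟩)·T^ε_{a_k,L^k,eA^{(k),ε}+e′Σ_{j=0}^{k−1}A′^{(j),ε}}[…]]"*
— the fluctuation fields are integrated against the product over j of the centred Gaussian densities with covariance
operators C^{(j),L^jε}, each normalised by its own prefactor, and the field A enters from outside (the ∫dA of (3.26)/(3.37)).

THE MODEL (schematic coordinates, cell DIVERGENCE D-b01.3, as in `…B1GaussNorm331`/`…B2Eq228Conditioning`).  A carrier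
`FluctData k`: for each `j : Fin k` a finite index type `ι j` (↤ the bonds of the lattice carrying A′_j, times vector
components) and a positive definite matrix `C j` (↤ C^{(j),L^jε}; positive definite by part I (2.17)/Prop. 2.3).  The law of
A′_j is `law j := B2Eq228Conditioning.gaussProb (C j)⁻¹` — p15's normalised-density Gaussian measure *"dμ_{M⁻¹} =
[∫dx e^{−½⟨x,Mx⟩}]⁻¹e^{−½⟨x,Mx⟩}dx"* at `M = (C j)⁻¹`, which IS the j-th factor of (3.35) after normalisation (`law_integral`)
and IS Mathlib's `multivariateGaussian 0 (C j)` read on `ι j → ℝ` (`law_eq_map_multivariateGaussian`).  The joint law of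
`(A′₀, …, A′_{k−1})` is the product `fluctLaw := Measure.pi law` on `FluctSpace := Π j, (ι j → ℝ)`; the field A (index
type `ιA`, ANY probability law `ν` — in (3.37) A is distributed by a non-Gaussian density, and only the product structure
is asserted in print) enters through `jointLaw ν := fluctLaw.prod ν` on `FluctSpace × (ιA → ℝ)`; the random variables are
the coordinates `ω ↦ ω.1 j` (↤ A′_j) and `ω ↦ ω.2` (↤ A).

WHAT THIS MODULE PROVES (kernel-checked, 0 `sorry`, standard axioms; THEOREMS ONLY plus the carrier).  §1 the carrier
and its probability instances.  §2 **«independent … random variables»**: `iIndepFun_fluct` (the coordinates A′_j are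
mutually independent under `jointLaw ν` — Mathlib `iIndepFun_pi` transported along the first projection,
`iIndepFun_comp_of_map_eq`), `iIndepFun_components` (hence so are the components A′^{(j),ε} = T_j(A′_j) of (3.33) for any
measurable maps T_j, e.g. (3.29)); **«Also they are independent of the field A»**: `indepFun_fluct_field`
((A′₀,…,A′_{k−1}) ⟂ A, Mathlib `indepFun_prod`) and `indepFun_fluct_field_at` (each A′_j ⟂ A).  §3 **«Gaussian … with the
covariances C^{(j),L^jε}»**: `map_fluct_eq_law` (the law of A′_j under `jointLaw ν` is `law j`), `law_integral` (= the
normalised density of (3.35)), `law_eq_map_multivariateGaussian`/`map_toLp_fluct_eq_multivariateGaussian` (= Mathlib's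
centred multivariate Gaussian with covariance matrix `C j`), `integral_fluct_apply` (mean zero) and **`covariance_fluct`**
(`cov[A′_j(a), A′_j(b)] = C^{(j)}_{ab}`, Mathlib `covariance_eval_multivariateGaussian`), `covariance_fluct_ne` (distinct
levels are uncorrelated: `cov[A′_i(a), A′_j(b)] = 0` for `i ≠ j`, from independence).
DICTIONARY (print ↦ Lean): A′_j ↦ `fun ω => ω.1 j`; C^{(j),L^jε} ↦ `D.C j`; "∫dA′_j exp(−½⟨A′_j,(C^{(j)})⁻¹A′_j⟩)·(…)
/normalisation" ↦ `∫ · ∂(D.law j)` (`law_integral`); A ↦ `fun ω => ω.2` with law `ν`; A′^{(j),ε} = (3.29)(A′_j) ↦ `T j (ω.1 j)`.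
NOT modelled: the identification of `C j` with the concrete operators C^{(j),L^jε} of (2.17) on the `HiggsLattice` model
(the typer's `HiggsCovariance` line), and the prefactors `(a(L^jε)^{d−2}/2π)^{(d/2)|T₁^{(j)}|}` of (3.35) as the VALUES of
the normalisations (that is r12's row B1.Eq3.31-3.32 / `…B1GaussNorm331`); here the normalisation is `gaussNorm`, whatever
its value.  Value = one SKELETON member proved in the schematic model; NOT summit progress.
-/

open MeasureTheory ProbabilityTheory Matrix

namespace Literature.MathematicalPhysics.QuantumFieldTheory.Balaban1983to89.B1Eq333GaussianFields

open B2Eq228Conditioning (gaussProb gaussProb_eq_map_multivariateGaussian isProbabilityMeasure_gaussProb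
  integral_gaussProb_eq)
open B13GaugeDevices (gaussWeight gaussNorm)

/-! ## §0 A transport lemma for mutual independence -/

/-- Mutual independence pulls back along a measure-preserving map: if `μ′.map g = μ` and the `f i` are independent
under `μ`, then the `f i ∘ g` are independent under `μ′` (both sides are the product-law characterisation
`iIndepFun_iff_map_fun_eq_pi_map`). [folklore] [cite: Balaban1982Higgs1, (3.33) p.617] -/
theorem iIndepFun_comp_of_map_eq {Ω Ω' : Type*} [MeasurableSpace Ω] [MeasurableSpace Ω'] {μ : Measure Ω}
    {μ' : Measure Ω'} [IsProbabilityMeasure μ] [IsProbabilityMeasure μ'] {I : Type*} [Fintype I] {β : I → Type*}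
    [∀ i, MeasurableSpace (β i)] {f : ∀ i, Ω → β i} (hf : ∀ i, Measurable (f i)) {g : Ω' → Ω}
    (hg : Measurable g) (hmap : μ'.map g = μ) (h : iIndepFun f μ) :
    iIndepFun (fun i ω' => f i (g ω')) μ' := by
  rw [iIndepFun_iff_map_fun_eq_pi_map fun i => (hf i).aemeasurable] at h
  have hfg : ∀ i, AEMeasurable (fun ω' => f i (g ω')) μ' := fun i => ((hf i).comp hg).aemeasurable
  rw [iIndepFun_iff_map_fun_eq_pi_map hfg]
  have h1 : (fun ω' i => f i (g ω')) = (fun ω i => f i ω) ∘ g := rfl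
  have h2 : ∀ i, (fun ω' => f i (g ω')) = f i ∘ g := fun i => rfl
  rw [h1, ← Measure.map_map (measurable_pi_lambda _ hf) hg, hmap, h]
  congr 1
  funext i
  rw [h2, ← Measure.map_map (hf i) hg, hmap]

/-! ## §1 The carrier: levels `j < k`, index types, covariances `C^{(j),L^jε}`; the laws -/

/-- The data of the sentence after (3.33): `k` levels; for each `j < k` the finite index type `ι j` of the fluctuation
field A′_j and its covariance matrix `C j` ↤ C^{(j),L^jε}, positive definite (part I (2.17), Prop. 2.3).
[cite: Balaban1982Higgs1, (3.33) p.617] -/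
structure FluctData (k : ℕ) where
  /-- index type of A′_j (bonds × components of the level-j lattice) -/
  ι : Fin k → Type
  fintype : ∀ j, Fintype (ι j)
  deceq : ∀ j, DecidableEq (ι j)
  /-- C^{(j),L^jε}, the covariance of A′_j -/
  C : ∀ j, Matrix (ι j) (ι j) ℝ
  posDef : ∀ j, (C j).PosDef

attribute [instance] FluctData.fintype FluctData.deceq

namespace FluctData

variable {k : ℕ} (D : FluctData k)

/-- `(C^{(j)})⁻¹` is positive definite. [cite: Balaban1982Higgs1, (3.35) p.618] -/
theorem inv_posDef (j : Fin k) : ((D.C j)⁻¹).PosDef := (D.posDef j).inv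

/-- `((C^{(j)})⁻¹)⁻¹ = C^{(j)}`. [cite: Balaban1982Higgs1, (3.35) p.618] -/
theorem inv_inv_C (j : Fin k) : (D.C j)⁻¹⁻¹ = D.C j :=
  Matrix.nonsing_inv_nonsing_inv _ (isUnit_iff_ne_zero.2 (D.posDef j).det_pos.ne')

/-- The law of A′_j: the probability measure on `ι j → ℝ` with the normalised density `exp(−½⟨A′,(C^{(j)})⁻¹A′⟩)` — the
j-th Gaussian factor of (3.35). [cite: Balaban1982Higgs1, (3.35) p.618] -/
noncomputable def law (j : Fin k) : Measure (D.ι j → ℝ) := gaussProb (D.C j)⁻¹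

/-- `law j` is a probability measure (the (3.35) factor is normalised). [cite: Balaban1982Higgs1, (3.35) p.618] -/
instance isProbabilityMeasure_law (j : Fin k) : IsProbabilityMeasure (D.law j) :=
  isProbabilityMeasure_gaussProb (D.inv_posDef j)

/-- The sample space of the fluctuation fields `(A′₀, …, A′_{k−1})`. [cite: Balaban1982Higgs1, (3.33) p.617] -/
abbrev FluctSpace : Type := ∀ j : Fin k, D.ι j → ℝ

/-- The joint law of `(A′₀, …, A′_{k−1})`: the product of the `law j` (the iterated Gaussian integrals of (3.35)).
[cite: Balaban1982Higgs1, (3.35) p.618] -/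
noncomputable def fluctLaw : Measure D.FluctSpace := Measure.pi D.law

/-- The joint law of the fluctuation fields is a probability measure. [cite: Balaban1982Higgs1, (3.35) p.618] -/
instance isProbabilityMeasure_fluctLaw : IsProbabilityMeasure D.fluctLaw := by
  unfold fluctLaw; infer_instance

/-- The joint law of the fluctuation fields AND the field A (index type `ιA`, law `ν`): the product — A is integrated
from outside in (3.26)/(3.37). [cite: Balaban1982Higgs1, (3.33) p.617] -/
noncomputable def jointLaw {ιA : Type} (ν : Measure (ιA → ℝ)) : Measure (D.FluctSpace × (ιA → ℝ)) :=
  D.fluctLaw.prod ν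

/-- The joint law of the fluctuation fields and A is a probability measure. [cite: Balaban1982Higgs1, (3.33) p.617] -/
instance isProbabilityMeasure_jointLaw {ιA : Type} (ν : Measure (ιA → ℝ)) [IsProbabilityMeasure ν] :
    IsProbabilityMeasure (D.jointLaw ν) := by
  unfold jointLaw; infer_instance

variable {ιA : Type} (ν : Measure (ιA → ℝ)) [IsProbabilityMeasure ν]

/-- The first marginal of the joint law is the law of the fluctuation fields. [cite: Balaban1982Higgs1, (3.33) p.617] -/
theorem map_fst_jointLaw : (D.jointLaw ν).map Prod.fst = D.fluctLaw := by
  rw [jointLaw, Measure.map_fst_prod, measure_univ, one_smul]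

/-- The second marginal of the joint law is the law `ν` of A. [cite: Balaban1982Higgs1, (3.33) p.617] -/
theorem map_snd_jointLaw : (D.jointLaw ν).map Prod.snd = ν := by
  rw [jointLaw, Measure.map_snd_prod, measure_univ, one_smul]

/-! ## §2 «independent … random variables», «independent of the field A» -/

/-- **p. 617, first clause**: the fluctuation fields `A′₀, …, A′_{k−1}` (the coordinates `ω ↦ ω.1 j`) are mutually
independent random variables. [cite: Balaban1982Higgs1, (3.33) p.617] -/
theorem iIndepFun_fluct : iIndepFun (fun (j : Fin k) (ω : D.FluctSpace × (ιA → ℝ)) => ω.1 j) (D.jointLaw ν) := by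
  have hpi : iIndepFun (fun (j : Fin k) (ω : D.FluctSpace) => ω j) D.fluctLaw :=
    iIndepFun_pi (μ := D.law) (X := fun j (x : D.ι j → ℝ) => x) fun _ => aemeasurable_id
  exact iIndepFun_comp_of_map_eq (fun j => measurable_pi_apply j) measurable_fst (D.map_fst_jointLaw ν) hpi

/-- Hence the components `A′^{(j),ε} = T_j(A′_j)` of (3.33) (*"given by the formula (3.29) with A′_j instead of A"* — any
measurable maps `T j`) are mutually independent as well. [cite: Balaban1982Higgs1, (3.33) p.617] -/
theorem iIndepFun_components {β : Fin k → Type} [∀ j, MeasurableSpace (β j)] (T : ∀ j, (D.ι j → ℝ) → β j)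
    (hT : ∀ j, Measurable (T j)) :
    iIndepFun (fun (j : Fin k) (ω : D.FluctSpace × (ιA → ℝ)) => T j (ω.1 j)) (D.jointLaw ν) :=
  (D.iIndepFun_fluct ν).comp T hT

/-- **p. 617, second clause**: the family of fluctuation fields `(A′₀, …, A′_{k−1})` is independent of the field A.
[cite: Balaban1982Higgs1, (3.33) p.617] -/
theorem indepFun_fluct_field :
    IndepFun (fun ω : D.FluctSpace × (ιA → ℝ) => ω.1) (fun ω => ω.2) (D.jointLaw ν) := by
  unfold jointLaw
  exact indepFun_prod (X := fun x : D.FluctSpace => x) (Y := fun a : ιA → ℝ => a) measurable_id measurable_id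

/-- Each single fluctuation field A′_j is independent of the field A. [cite: Balaban1982Higgs1, (3.33) p.617] -/
theorem indepFun_fluct_field_at (j : Fin k) :
    IndepFun (fun ω : D.FluctSpace × (ιA → ℝ) => ω.1 j) (fun ω => ω.2) (D.jointLaw ν) := by
  unfold jointLaw
  exact indepFun_prod (X := fun x : D.FluctSpace => x j) (Y := fun a : ιA → ℝ => a) (measurable_pi_apply j)
    measurable_id

/-! ## §3 «Gaussian … with the covariances C^{(j),L^jε}» -/

/-- The law of A′_j under the joint law is `law j`. [cite: Balaban1982Higgs1, (3.35) p.618] -/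
theorem map_fluct_eq_law (j : Fin k) :
    (D.jointLaw ν).map (fun ω : D.FluctSpace × (ιA → ℝ) => ω.1 j) = D.law j := by
  have h : (fun ω : D.FluctSpace × (ιA → ℝ) => ω.1 j) = Function.eval j ∘ Prod.fst := rfl
  rw [h, ← Measure.map_map (measurable_pi_apply j) measurable_fst, D.map_fst_jointLaw ν, fluctLaw]
  exact (measurePreserving_eval D.law j).map_eq

/-- `law j` integrates as the normalised Gaussian density of (3.35):
`∫F dlaw_j = [∫dA′ e^{−½⟨A′,(C^{(j)})⁻¹A′⟩}]⁻¹ ∫dA′ e^{−½⟨A′,(C^{(j)})⁻¹A′⟩}F(A′)`. [cite: Balaban1982Higgs1, (3.35) p.618] -/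
theorem law_integral (j : Fin k) (F : (D.ι j → ℝ) → ℝ) :
    ∫ x, F x ∂(D.law j) = (gaussNorm (D.C j)⁻¹)⁻¹ * ∫ x, gaussWeight (D.C j)⁻¹ x * F x :=
  integral_gaussProb_eq _ F

/-- `law j` is Mathlib's centred multivariate Gaussian with covariance matrix `C^{(j)}` (read on `ι j → ℝ` through the
coordinate equivalence). [cite: Balaban1982Higgs1, (3.33) p.617] -/
theorem law_eq_map_multivariateGaussian (j : Fin k) :
    D.law j = (multivariateGaussian 0 (D.C j)).map ⇑(MeasurableEquiv.toLp 2 (D.ι j → ℝ)).symm := by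
  rw [law, gaussProb_eq_map_multivariateGaussian (D.inv_posDef j), inv_inv_C]

/-- The law of A′_j, as a vector of `EuclideanSpace ℝ (ι j)`, is `multivariateGaussian 0 (C j)`.
[cite: Balaban1982Higgs1, (3.33) p.617] -/
theorem map_toLp_fluct_eq_multivariateGaussian (j : Fin k) :
    (D.jointLaw ν).map (fun ω : D.FluctSpace × (ιA → ℝ) => WithLp.toLp 2 (ω.1 j))
      = multivariateGaussian 0 (D.C j) := by
  set e := MeasurableEquiv.toLp 2 (D.ι j → ℝ) with he
  have h : (fun ω : D.FluctSpace × (ιA → ℝ) => WithLp.toLp 2 (ω.1 j))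
      = ⇑e ∘ (fun ω : D.FluctSpace × (ιA → ℝ) => ω.1 j) := rfl
  rw [h, ← Measure.map_map e.measurable ((measurable_pi_apply j).comp measurable_fst), map_fluct_eq_law,
    law_eq_map_multivariateGaussian, Measure.map_map e.measurable e.symm.measurable, MeasurableEquiv.self_comp_symm,
    Measure.map_id]

/-- **Mean zero**: `E[A′_j(a)] = 0`. [cite: Balaban1982Higgs1, (3.33) p.617] -/
theorem integral_fluct_apply (j : Fin k) (a : D.ι j) :
    ∫ ω, ω.1 j a ∂(D.jointLaw ν) = 0 := by
  have hZ : Measurable (fun ω : D.FluctSpace × (ιA → ℝ) => WithLp.toLp 2 (ω.1 j)) :=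
    (WithLp.measurable_toLp 2 _).comp ((measurable_pi_apply j).comp measurable_fst)
  have hX : Measurable (fun x : EuclideanSpace ℝ (D.ι j) => x a) := by fun_prop
  have h1 : ∫ ω, ω.1 j a ∂(D.jointLaw ν)
      = ∫ x, (fun x : EuclideanSpace ℝ (D.ι j) => x a) x
          ∂((D.jointLaw ν).map (fun ω : D.FluctSpace × (ιA → ℝ) => WithLp.toLp 2 (ω.1 j))) := by
    rw [integral_map hZ.aemeasurable hX.aestronglyMeasurable]
  rw [h1, map_toLp_fluct_eq_multivariateGaussian]
  have h2 := (measurePreserving_eval_multivariateGaussian (μ := (0 : EuclideanSpace ℝ (D.ι j)))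
    (D.posDef j).posSemidef (i := a)).map_eq
  have h3 : ∫ t, t ∂((multivariateGaussian 0 (D.C j)).map (fun x : EuclideanSpace ℝ (D.ι j) => x a))
      = ∫ x, (fun x : EuclideanSpace ℝ (D.ι j) => x a) x ∂(multivariateGaussian 0 (D.C j)) :=
    integral_map (φ := fun x : EuclideanSpace ℝ (D.ι j) => x a) (f := fun t : ℝ => t) hX.aemeasurable
      aestronglyMeasurable_id
  rw [← h3, h2, integral_id_gaussianReal]
  simp

/-- **p. 617: «Gaussian random variables with the covariances C^{(j),L^jε}»** — the covariance of the coordinates of A′_j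
under the joint law is the matrix `C^{(j)}`: `cov[A′_j(a), A′_j(b)] = C^{(j)}_{ab}`. [cite: Balaban1982Higgs1, (3.33) p.617] -/
theorem covariance_fluct (j : Fin k) (a b : D.ι j) :
    cov[fun ω : D.FluctSpace × (ιA → ℝ) => ω.1 j a, fun ω => ω.1 j b; D.jointLaw ν] = D.C j a b := by
  have hZ : Measurable (fun ω : D.FluctSpace × (ιA → ℝ) => WithLp.toLp 2 (ω.1 j)) :=
    (WithLp.measurable_toLp 2 _).comp ((measurable_pi_apply j).comp measurable_fst)
  have hXa : Measurable (fun x : EuclideanSpace ℝ (D.ι j) => x a) := by fun_prop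
  have hXb : Measurable (fun x : EuclideanSpace ℝ (D.ι j) => x b) := by fun_prop
  have h := covariance_map (μ := D.jointLaw ν) hXa.aestronglyMeasurable hXb.aestronglyMeasurable hZ.aemeasurable
  rw [map_toLp_fluct_eq_multivariateGaussian, covariance_eval_multivariateGaussian (D.posDef j).posSemidef] at h
  rw [h]
  rfl

/-- Distinct levels are uncorrelated: `cov[A′_i(a), A′_j(b)] = 0` for `i ≠ j` (a consequence of independence and square
integrability). [cite: Balaban1982Higgs1, (3.33) p.617] -/
theorem covariance_fluct_ne {i j : Fin k} (hij : i ≠ j) (a : D.ι i) (b : D.ι j) :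
    cov[fun ω : D.FluctSpace × (ιA → ℝ) => ω.1 i a, fun ω => ω.1 j b; D.jointLaw ν] = 0 := by
  have hind : IndepFun (fun ω : D.FluctSpace × (ιA → ℝ) => ω.1 i a) (fun ω => ω.1 j b) (D.jointLaw ν) := by
    have h2 := (D.iIndepFun_fluct ν).indepFun hij
    exact h2.comp (φ := fun x : D.ι i → ℝ => x a) (ψ := fun x : D.ι j → ℝ => x b) (measurable_pi_apply a)
      (measurable_pi_apply b)
  have hmem : ∀ (l : Fin k) (c : D.ι l), MemLp (fun ω : D.FluctSpace × (ιA → ℝ) => ω.1 l c) 2 (D.jointLaw ν) := by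
    intro l c
    have hZ : Measurable (fun ω : D.FluctSpace × (ιA → ℝ) => WithLp.toLp 2 (ω.1 l)) :=
      (WithLp.measurable_toLp 2 _).comp ((measurable_pi_apply l).comp measurable_fst)
    have hG : MemLp (fun x : EuclideanSpace ℝ (D.ι l) => x c) 2
        ((D.jointLaw ν).map (fun ω : D.FluctSpace × (ιA → ℝ) => WithLp.toLp 2 (ω.1 l))) := by
      rw [map_toLp_fluct_eq_multivariateGaussian, ← EuclideanSpace.coe_proj ℝ]
      exact IsGaussian.memLp_dual _ (EuclideanSpace.proj c) 2 (by simp)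
    exact hG.comp_of_map hZ.aemeasurable
  exact hind.covariance_eq_zero (hmem i a) (hmem j b)

end FluctData

end Literature.MathematicalPhysics.QuantumFieldTheory.Balaban1983to89.B1Eq333GaussianFields
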